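import Summits.QuantumFields.BalabanUV.T4Continuum.Support.SubstrateBlockAvgContinuity

/-!
# SUBSTRATE — THE DRIVEN TWO-RUN OBJECT OF RECORD AT THE SMALL-LOOP AVERAGE OF RECORD WITH NO DISPLAYED HYPOTHESIS: the class
# `nestedSmallAll ℰ δ′ = ⋂ₖ NestedSmall ℰ δ′ k` (small along the whole unguarded orbit) is closed and contains `1`, so
# `drivenOfRecordSU` is INHABITED outright — `drivenRecordSU F K m′ : DrivenRuns SU(n)` with `1 ∈ domV`, `uA 1 = uB 1 = 1`

Cell `pub-balaban`, SUBSTRATE cell, seat `b2b-balaban-substrate-p2`; follower of `SubstrateBlockAvgContinuity` (p220282) closing MAP v0.4 §O1 O-1's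
non-vacuity AT THE `ℰ` OF RECORD (`ExpMeanLog.expMeanLogSU`): the O-1 object exists with NO displayed hypothesis for the class
`⋂ₖ NestedSmall expMeanLogSU (δ_SU/2) k`.  Whether Bałaban's small-PLAQUETTE class sits inside this class is the one-step regularity
ESTIMATE ([Balaban1985Averaging] Prop. 2) — displayed where needed, never substrate; this file does not claim it.  Edits nothing.

HONEST FRAMING (T4-DAG p. 1).  Rung (B)+1 of the FINITE-VOLUME T⁴ continuum programme — NOT infinite volume, NOT a mass gap, NOT the
Clay problem, NOT summit progress, no estimate.  HONEST DEPENDENCY (cell line, verbatim): continuum YM on T⁴ ⇐ BetaPertH ∧ nine spine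
estimates (0/9 proved); BetaPertH ⇐ (D1) ∧ (D4) ∧ CAP+tail; G-an2-4 gates asym, D1 and NE2/3/4.

* §1 `nestedSmallAll ℰ δ′ := ⋂ k, NestedSmall ℰ δ′ k`; `nestedSmallAll_subset`, `isClosed_nestedSmallAll`, `one_mem_nestedSmallAll`.
* §2 **`drivenRecordSU F K m′ gA gB : DrivenRuns (Matrix.specialUnitaryGroup n ℂ)`** := `drivenOfRecordSU` on the classes `nestedSmallAll expMeanLogSU (δ_SU/2)`
  of the two tori; **`one_mem_domV_drivenRecordSU`**, **`uA_one_drivenRecordSU`**, **`uB_one_drivenRecordSU`** — hypothesis-free.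
No estimate, no `def … : Prop`, no `sorry`.
-/

noncomputable section

open scoped BigOperators Topology

namespace Summit.QuantumFields.BalabanUV.T4Continuum.SubstrateBlockAvgContinuity

open Literature.MathematicalPhysics.QuantumFieldTheory.Balaban1983to89
open Literature.MathematicalPhysics.QuantumFieldTheory.Balaban1983to89.T4Continuum (T4Family)
open Summit.QuantumFields.BalabanUV.T4Continuum.SubstrateTwoRunsDriven
open ExpMeanLog

variable {P : Params} {G : Type*} [GaugeGroup G] (ℰ : LoopAverage G)

/-! ## §1 The all-level nested class -/

/-- [folklore] THE ALL-LEVEL NESTED SMALL-LOOP CLASS: small (margin `δ′`) at every level along the unguarded (0.4) orbit. -/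
def nestedSmallAll (δ' : ℝ) : Set (GaugeField P 0 G) := ⋂ k, NestedSmall ℰ δ' k

/-- [folklore] It lies in every finite-level nested class. -/
theorem nestedSmallAll_subset (δ' : ℝ) (k : ℕ) : nestedSmallAll (P := P) ℰ δ' ⊆ NestedSmall ℰ δ' k :=
  Set.iInter_subset _ k

/-- [folklore] It is CLOSED (topological group, continuous `dist1`, `ℰ` continuous on small families, `δ′ < ℰ.δ`). -/
theorem isClosed_nestedSmallAll [TopologicalSpace G] [IsTopologicalGroup G] (hd : Continuous (dist1 : G → ℝ)) (hE : SmallContinuous ℰ)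
    {δ' : ℝ} (hδ : δ' < ℰ.δ) : IsClosed (nestedSmallAll (P := P) ℰ δ') :=
  isClosed_iInter fun k => isClosed_nestedSmall ℰ hd hE hδ k

/-- [folklore] It contains the trivial configuration (`ℰ` normalised at identity families, `0 ≤ δ′`). -/
theorem one_mem_nestedSmallAll (hE : ∀ m : ℕ, ℰ.E (fun _ : Fin (m + 1) => (1 : G)) = 1) {δ' : ℝ} (hδ' : 0 ≤ δ') :
    (1 : GaugeField P 0 G) ∈ nestedSmallAll ℰ δ' :=
  Set.mem_iInter.2 fun k => one_mem_nestedSmall ℰ hE hδ' k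

/-! ## §2 The driven two-run object of record on `SU(n)` with no displayed hypothesis -/

section SU

variable {n : Type} [Fintype n] [DecidableEq n] [Nonempty n]

/-- [folklore] Half the radius of the `SU(n)` average of record is a legitimate margin: `0 ≤ δ_SU/2 < δ_SU`. -/
theorem half_deltaSU_lt : (expMeanLogSU (n := n)).δ / 2 < (expMeanLogSU (n := n)).δ :=
  half_lt_self (expMeanLogSU (n := n)).δ_pos

/-- [folklore] `0 ≤ δ_SU/2`. -/
theorem half_deltaSU_nonneg : 0 ≤ (expMeanLogSU (n := n)).δ / 2 :=
  le_of_lt (half_pos (expMeanLogSU (n := n)).δ_pos)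

/-- [folklore] **THE DRIVEN TWO-RUN OBJECT OF RECORD AT `ℰ = expMeanLogSU`, HYPOTHESIS-FREE**: both runs' classes are the all-level nested
small-loop classes with margin `δ_SU/2` on the tori `F.P K`, `F.P (K+1)`; backgrounds = constrained Wilson minimisers by compactness with
continuity of `M^k` ON the classes (`drivenOfRecordSU`); couplings `gA`, `gB`. -/
def drivenRecordSU (F : T4Family) (K m' : ℕ) (gA gB : ℕ → ℝ) : DrivenRuns (Matrix.specialUnitaryGroup n ℂ) :=
  drivenOfRecordSU F K m' half_deltaSU_lt
    (nestedSmallAll expMeanLogSU ((expMeanLogSU (n := n)).δ / 2))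
    (isClosed_nestedSmallAll _ continuous_dist1_SU smallContinuous_expMeanLogSU half_deltaSU_lt)
    (one_mem_nestedSmallAll _ (fun _ => ESU_const_one) half_deltaSU_nonneg)
    (fun k => nestedSmallAll_subset _ _ k)
    (nestedSmallAll expMeanLogSU ((expMeanLogSU (n := n)).δ / 2))
    (isClosed_nestedSmallAll _ continuous_dist1_SU smallContinuous_expMeanLogSU half_deltaSU_lt)
    (one_mem_nestedSmallAll _ (fun _ => ESU_const_one) half_deltaSU_nonneg)
    (fun k => nestedSmallAll_subset _ _ k) gA gB

/-- [folklore] **`1 ∈ domV`, HYPOTHESIS-FREE**, for the object of record on `SU(n)`. -/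
theorem one_mem_domV_drivenRecordSU (F : T4Family) (K m' : ℕ) (gA gB : ℕ → ℝ) :
    (1 : UnitField F (Matrix.specialUnitaryGroup n ℂ)) ∈ (drivenRecordSU (n := n) F K m' gA gB).domV :=
  one_mem_domV_drivenOfRecordSU F K m' _ _ _ _ _ _ _ _ _ gA gB

/-- [folklore] **`oneA`, HYPOTHESIS-FREE**: run A's background of the trivial driving field is trivial. -/
theorem uA_one_drivenRecordSU (F : T4Family) (K m' : ℕ) (gA gB : ℕ → ℝ) :
    ((drivenRecordSU (n := n) F K m' gA gB).uA ⟨1, one_mem_domV_drivenRecordSU F K m' gA gB⟩).1 = 1 :=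
  uA_one_drivenOfRecordSU F K m' _ _ _ _ _ _ _ _ _ gA gB

/-- [folklore] **`oneB`, HYPOTHESIS-FREE**. -/
theorem uB_one_drivenRecordSU (F : T4Family) (K m' : ℕ) (gA gB : ℕ → ℝ) :
    ((drivenRecordSU (n := n) F K m' gA gB).uB ⟨1, one_mem_domV_drivenRecordSU F K m' gA gB⟩).1 = 1 :=
  uB_one_drivenOfRecordSU F K m' _ _ _ _ _ _ _ _ _ gA gB

end SU

end Summit.QuantumFields.BalabanUV.T4Continuum.SubstrateBlockAvgContinuity

end
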